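import Literature.MathematicalPhysics.QuantumFieldTheory.Balaban1983to89.B9Eq3153FrakGkBoundDiagonal
import Literature.MathematicalPhysics.QuantumFieldTheory.Balaban1983to89.B7Eq43AveragedSmallnessLevelFree

/-!
# `Balaban1983to89.B9Eq3153FrakGkBoundTwoWindows` — T. Bałaban, *Propagators for lattice gauge theories in a background field*, Commun. Math. Phys. **99**
# (1985) 389–434 [Balaban1985BackgroundPropagators] Thm 3.13's `L²`∕energy clause via (3.126) p. 420, (3.153) p. 426, Thm 3.11 p. 416, (3.35)–(3.37) p. 396;
# [Balaban1985Averaging] Prop. 2 (52)–(54) p. 26: **THE THREE GREEN's LETTERS `G_k`, `H_{1,k}Q_kG_k`, `𝔊_k` OF THE `k`-TH STEP ON PRINT's DIAGONAL FROM THE TWO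
# WINDOWS OF (3.35)** — the row owner's `B9Eq3153FrakGkBoundDiagonal.exists_energy_letters_diagonal_closed ∕ exists_norm_G1k_rows_le_diagonal_closed ∕
# exists_norm_H1k_Qk_G1k_le_diagonal_closed ∕ exists_norm_frakGk_le_diagonal_closed` (g86 INTENT-2) RE-ISSUED with the level-profile binders `εU`, `0 ≤ εU j`,
# `‖Ū^j(b) − 1‖ ≤ εU j`, `εU j ≤ αr^j` and `r` STRUCK (inhabited at `r = 1∕L` by `B7Eq43AveragedSmallnessLevelFree.exists_profile_of_windows_eta`) — the
# background valued in an averaging-closed `S ≤ U1`, bonds `αη`-close, plaquettes `αη²`-close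

statement-level skeleton of published theorems with citation tags; proofs where landed; nothing here is a claim about the Yang–Mills mass gap

CITATION HEADER (lean-in-tree rule).  Audit cell `pub-balaban`, sub-cell `t4`, BINDER row NE9; filed by NE9 formalisation-swarm leaf prover 03
(`b2b-balaban-t4-ne9-formalise-leaf-03`, gen 65), INTENT I-ne9leaf03-g65-5 — the window derivation applied to the owner g86's Green's letters (W-1 of this seat's
ONLINE line: «I re-issue the closed theorems with two windows after yours land»).  Sources READ in the held text `paper:balaban1985-cmp99-background-propagators`:
pp. 396, 416, 420, 426.  Objects BY NAME: the owner's `laplaceAk`, `QkW`, `RofUk`, `G1LatticeK`, `H1LatticeK`, `frakGLatticeK`; nothing re-declared, 0 `def`.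

THE PRINT (verbatim).  p. 426: *«(3.147), (3.153) permit us to reduce properties of 𝔓, 𝔊 to the corresponding properties of G′, (Q′G′²Q′*)⁻¹, G₁, (QG₁Q*)⁻¹ …
Theorem 3.13»*; p. 396 (3.35): the TWO displays `|A| < O(1)Mα₀(L^jη)⁻¹`, `|∇^η_U A| < O(1)Mα₀(L^jη)⁻²` — the smallness of the averaged configurations ((3.37),
[Balaban1985Averaging] (53)–(54)) is a consequence.

WHAT IS PROVED (sorry-free; proof lane — 0 `def`; [folklore] binder plumbing over the owner's landed file and this lineage's supplier).  With `α₀` the minimum of the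
owner's threshold over `1 + 512(d+1)(d+4)` and the class thresholds `1∕(6C₀)`, `c₂′∕4`; `U : Bond(T_{L^{n+1}m}) → S` (`S ≤ U1` averaging-closed), `0 ≤ α ≤ α₀`,
`‖U(b) − 1‖ ≤ αη`, `‖U(∂p) − 1‖ ≤ αη²`, E162's per-level data, `hRS`, the point `ηL^{n+1} = 1`, `c₀(L^{n+1})^d = c₁`, `|η|^d∕c₀ ≤ ρ_w`:
* **`exists_energy_letters_twoWindows`** (the owner's (B1): strong coercivity of the FULL operator with curvature + the `RD*`- and `Q`-letters),
  **`exists_norm_G1k_rows_le_twoWindows`** ((B2): the flat `D`-rows of `G_k(U)y`), **`exists_norm_H1k_Qk_G1k_le_twoWindows`** ((B3), under `hsymm`, any `hpos`,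
  any `hQ`), **`exists_norm_frakGk_le_twoWindows`** ((B4): `‖𝔊_k(U)x‖, ‖curl₁(𝔊_k(U)x)‖, ‖div₁(𝔊_k(U)x)‖ ≤ C‖x‖`) — same constants `γ₁`, `C` as the owner's at `r = 1∕L`.
HONEST SCOPE.  [folklore]; NOT the bond window from plaquettes (global torus: false; per cube: IMS road); no decay; «NE9 ⇐ the named binders»; NE9 NOT PRINTED ∕ NOT
PROVED; NOT summit progress (cell pub-balaban: row NE9 WALLED ON A MODEL; spine PROVED 0/9; rung (B)+1 finite T⁴ — NOT infinite volume, NOT mass gap, NOT Clay;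
HONEST DEPENDENCY: continuum YM on T⁴ ⇐ BetaPertH ∧ nine spine estimates (0/9 proved); BetaPertH ⇐ (D1) ∧ (D4) ∧ CAP+tail; G-an2-4 gates asym, D1 and NE2/3/4).
NEW file; modifies nothing.  Net new unproved facts: 0.
-/

noncomputable section

open scoped InnerProductSpace ComplexConjugate BigOperators

namespace Literature.MathematicalPhysics.QuantumFieldTheory.Balaban1983to89.B9Eq3153FrakGkBoundTwoWindows

open B4Sect5Torus (TSite)
open B9SectCLatticeCarrier (Bond)
open B11Eq103H1Complex (SiteL2K BondL2K covDivL2K G1LatticeK H1LatticeK frakGLatticeK)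
open B9Eq310HessianOperator (adTransportW covCurlL2K)
open B9Eq310DeltaPrime (plaqHolU)
open B9Eq315QTorus (perCfg cornerSite)
open B9Eq315QTower (towerP UlevOf)
open B9Eq326OperatorTower (QkW RofUk laplaceAk)
open B7Prop1Explicit (U1 Wcx boxVec)
open B7Prop2Explicit (C0 c2' AvgClosed C0_pos c2'_pos)
open B7Eq43AveragedSmallnessLevelFree (exists_profile_of_windows_eta)
open B9Eq3153FrakGkBoundDiagonal (exists_energy_letters_diagonal_closed exists_norm_G1k_rows_le_diagonal_closed exists_norm_H1k_Qk_G1k_le_diagonal_closed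
  exists_norm_frakGk_le_diagonal_closed)

variable {d : ℕ} (L : ℕ) [NeZero L] (hL : 1 ≤ L) (hL2 : 2 ≤ L) {𝔸 : Type*} [NormedRing 𝔸] [NormedAlgebra ℂ 𝔸] [CompleteSpace 𝔸] [NormOneClass 𝔸]

/-! ## §1 The struck binders, inhabited (as in `B9Thm311SmallFieldCoercivityTowerTwoWindows`) -/

section Feed

include hL2 in
/-- From the two windows at `α ≤ α₀` and the class thresholds on `2α₀`: `U ∈ U1`, the bond ∕ plaquette windows at the owner's `α₁ ≥ (1 + 512(d+1)(d+4))α₀`, and a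
level profile `εU ≤ α₁(1∕L)^j` (`exists_profile_of_windows_eta` at the class constant `2α₀ > α`). [folklore] -/
private theorem windows_feed (m : Fin d → ℕ) [∀ i, NeZero (m i)] (n : ℕ) {S : Subgroup 𝔸ˣ} (hS : AvgClosed d L S)
    {U : Bond d (towerP L m (n + 1)) → 𝔸ˣ} (hU : ∀ b, U b ∈ S) {α₁ α₀ α η : ℝ} (hα₀ : 0 < α₀) (hCw : α₀ * (1 + 512 * (d + 1) * (d + 4)) ≤ α₁)
    (h3 : C0 d * (2 * α₀) ≤ 1 / 3) (h2 : 2 * (2 * α₀) ≤ c2' d L) (hηL : η * (L : ℝ) ^ (n + 1) = 1) (hα0 : 0 ≤ α) (hαle : α ≤ α₀)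
    (hUη : ∀ b, ‖(U b : 𝔸) - 1‖ ≤ α * η) (hpl : ∀ p : B9SectCLatticeCarrier.Plaq d (towerP L m (n + 1)), ‖(plaqHolU U p : 𝔸) - 1‖ ≤ α * η ^ 2) :
    (∀ b, U b ∈ U1 𝔸) ∧ (∀ b, ‖(U b : 𝔸) - 1‖ ≤ α₁ * η) ∧
      (∀ p : B9SectCLatticeCarrier.Plaq d (towerP L m (n + 1)), ‖(plaqHolU U p : 𝔸) - 1‖ ≤ α₁ * η ^ 2) ∧
      ∃ εU : ℕ → ℝ, (∀ j, 0 ≤ εU j) ∧ (∀ (j : ℕ) (b : Bond d (towerP L m (j + 1))), ‖(UlevOf L m (n + 1) U j b : 𝔸) - 1‖ ≤ εU j) ∧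
        ∀ j < n + 1, εU j ≤ α₁ * (1 / (L : ℝ)) ^ j := by
  have hL0 : (0 : ℝ) < L := by exact_mod_cast lt_of_lt_of_le (by norm_num) hL2
  have hL1 : (1 : ℝ) ≤ L := by exact_mod_cast le_trans (by norm_num) hL2
  have hη : η = ((L : ℝ) ^ (n + 1))⁻¹ := (inv_eq_of_mul_eq_one_left hηL).symm
  have hη0 : 0 < η := by rw [hη]; positivity
  have hαlt : α < 2 * α₀ := by linarith
  have hd : (0 : ℝ) ≤ 512 * (d + 1) * (d + 4) := by positivity
  have hα₁ : α ≤ α₁ := by nlinarith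
  obtain ⟨εU, hεU, hUε, hεg⟩ := exists_profile_of_windows_eta L m n hL2 hS hU (α₀ := 2 * α₀) (by positivity) h3 h2 hηL hα0 hαlt hUη hpl
  refine ⟨fun b => hS.le_U1 (hU b), fun b => (hUη b).trans (mul_le_mul_of_nonneg_right hα₁ hη0.le),
    fun p => (hpl p).trans (mul_le_mul_of_nonneg_right hα₁ (by positivity)), εU, hεU, hUε, fun j hj => (hεg j hj).trans ?_⟩
  have hB0 : 0 ≤ α + 256 * (d + 1) * (d + 4) * (2 * α₀) := by positivity
  have hB : α + 256 * (d + 1) * (d + 4) * (2 * α₀) ≤ α₁ := by nlinarith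
  exact mul_le_mul_of_nonneg_right ((div_le_self hB0 hL1).trans hB) (by positivity)

omit [NeZero L] in
include hL2 in
/-- The three thresholds below one name. [folklore] -/
private theorem thresholds {α₁ : ℝ} (hα₁ : 0 < α₁) :
    ∃ T : ℝ, 0 < T ∧ T * (1 + 512 * (d + 1) * (d + 4)) ≤ α₁ ∧ C0 d * (2 * T) ≤ 1 / 3 ∧ 2 * (2 * T) ≤ c2' d L := by
  have hC0 := C0_pos d
  have hc2 := c2'_pos d L (le_trans (by norm_num) hL2)
  refine ⟨min (α₁ / (1 + 512 * (d + 1) * (d + 4))) (min (1 / (6 * C0 d)) (c2' d L / 4)),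
    lt_min (by positivity) (lt_min (by positivity) (by positivity)), ?_, ?_, ?_⟩
  · rw [← le_div_iff₀ (by positivity)]; exact min_le_left _ _
  · have hA3 : min (α₁ / (1 + 512 * (d + 1) * (d + 4))) (min (1 / (6 * C0 d)) (c2' d L / 4)) ≤ 1 / (6 * C0 d) :=
      (min_le_right _ _).trans (min_le_left _ _)
    have h := mul_le_mul_of_nonneg_left hA3 hC0.le
    rw [mul_one_div, show C0 d / (6 * C0 d) = 1 / 6 by field_simp] at h
    linarith
  · have hA2 : min (α₁ / (1 + 512 * (d + 1) * (d + 4))) (min (1 / (6 * C0 d)) (c2' d L / 4)) ≤ c2' d L / 4 :=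
      (min_le_right _ _).trans (min_le_right _ _)
    linarith

end Feed

/-! ## §2 The owner's four Green's-letter theorems, two-windowed -/

section Green

variable [StarRing 𝔸] [NormedStarGroup 𝔸] [StarModule ℂ 𝔸]
  {W : Type*} [NormedAddCommGroup W] [InnerProductSpace ℂ W] [FiniteDimensional ℂ W] (φ : W ≃ₗ[ℂ] 𝔸)
  {Mφ Mφ' : ℝ} (hMφ : 0 ≤ Mφ) (hMφ' : 0 ≤ Mφ') (hφ : ∀ w, ‖φ w‖ ≤ Mφ * ‖w‖) (hφ' : ∀ X, ‖φ.symm X‖ ≤ Mφ' * ‖X‖) {a : ℝ} (ha : 0 < a)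
  (τ : 𝔸 →ₗ[ℂ] ℂ) {Cτ : ℝ} (hτ : ∀ X, ‖τ X‖ ≤ Cτ * ‖X‖) (hCτ : 0 ≤ Cτ) {ρw : ℝ} (hρw : 0 ≤ ρw)

include hL2 hMφ hMφ' hφ hφ' ha hτ hCτ hρw

/-- **THE ENERGY LETTERS OF PRINT's `k`-TH-STEP OPERATOR ON THE DIAGONAL FROM THE TWO WINDOWS** (the owner's (B1) re-issued): `∃ α₀ γ₁ > 0` before every binder;
(i) `γ₁(‖curl₁x‖² + ‖div₁x‖² + ‖x‖²) ≤ re⟨x, Δ^{(n+1)}_a(U)x⟩`, (ii) `‖R_k(U)(D*_Ux)‖² ≤ 2·re⟨x, Δ_a x⟩`, (iii) `a‖Q_k(U)x‖² ≤ 2·re⟨x, Δ_a x⟩`.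
[cite: Balaban1985BackgroundPropagators, Thm 3.11 p.416, (3.26) p.395, (3.35)–(3.37) p.396; Balaban1985Averaging, Prop. 2 (52)–(54) p.26] -/
theorem exists_energy_letters_twoWindows :
    ∃ α₀ γ₁ : ℝ, 0 < α₀ ∧ 0 < γ₁ ∧ ∀ (n : ℕ) (η : ℝ), η * (L : ℝ) ^ (n + 1) = 1 →
      ∀ (c₀ c₁ : ℝ) [Fact (0 < c₀)] [Fact (0 < c₁)], c₀ * ((L : ℝ) ^ (n + 1)) ^ d = c₁ → |η| ^ d / c₀ ≤ ρw →
      ∀ (m : Fin d → ℕ) [∀ i, NeZero (m i)] (U : Bond d (towerP L m (n + 1)) → 𝔸ˣ) (αU : ℕ → ℝ) (hα1 : ∀ j, αU j ≤ 1 / 64)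
        (hU1 : ∀ (j : ℕ) (x : B7Prop1Explicit.Site d) (κ : Fin d), perCfg (towerP L m (j + 1)) (UlevOf L m (n + 1) U j) x κ ∈ U1 𝔸)
        (hreg : ∀ (j : ℕ) (y : TSite d (towerP L m j)) (κ : Fin d) (r : Fin d → Fin L),
          ‖((Wcx L (perCfg (towerP L m (j + 1)) (UlevOf L m (n + 1) U j)) (cornerSite L y) κ (boxVec L r) : 𝔸ˣ) : 𝔸) - 1‖ ≤ αU j)
        {S : Subgroup 𝔸ˣ}, AvgClosed d L S → (∀ b, U b ∈ S) →
      ∀ {α : ℝ}, 0 ≤ α → α ≤ α₀ →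
        (∀ (b : Bond d (towerP L m (n + 1))) (v u : W), ⟪adTransportW φ U b v, u⟫_ℂ = ⟪v, adTransportW φ (fun b => (U b)⁻¹) b u⟫_ℂ) →
        (∀ b, ‖(U b : 𝔸) - 1‖ ≤ α * η) →
        (∀ p : B9SectCLatticeCarrier.Plaq d (towerP L m (n + 1)), ‖(plaqHolU U p : 𝔸) - 1‖ ≤ α * η ^ 2) →
        ∀ x : BondL2K ℂ d (towerP L m (n + 1)) c₀ W,
          γ₁ * (‖covCurlL2K ℂ c₀ ((η : ℂ))⁻¹ (adTransportW φ (fun _ : Bond d (towerP L m (n + 1)) => (1 : 𝔸ˣ))) x‖ ^ 2 +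
              ‖covDivL2K ℂ c₀ ((η : ℂ))⁻¹ (adTransportW φ fun _ : Bond d (towerP L m (n + 1)) => (1 : 𝔸ˣ)⁻¹) x‖ ^ 2 + ‖x‖ ^ 2) ≤
            RCLike.re ⟪x, laplaceAk L m n φ η U hL αU hα1 hU1 hreg τ (c₀ := c₀) (c₁ := c₁) a x⟫_ℂ ∧
          ‖RofUk L m n φ η U (covDivL2K ℂ c₀ ((η : ℂ))⁻¹ (adTransportW φ fun b => (U b)⁻¹) x)‖ ^ 2 ≤
            2 * RCLike.re ⟪x, laplaceAk L m n φ η U hL αU hα1 hU1 hreg τ (c₀ := c₀) (c₁ := c₁) a x⟫_ℂ ∧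
          a * ‖QkW L m n φ U hL αU hα1 hU1 hreg (c₁ := c₁) x‖ ^ 2 ≤
            2 * RCLike.re ⟪x, laplaceAk L m n φ η U hL αU hα1 hU1 hreg τ (c₀ := c₀) (c₁ := c₁) a x⟫_ℂ := by
  have hL0 : (0 : ℝ) < L := by exact_mod_cast lt_of_lt_of_le (by norm_num) hL2
  have hr0 : (0 : ℝ) ≤ 1 / (L : ℝ) := by positivity
  have hr1 : 1 / (L : ℝ) < 1 := by rw [div_lt_one hL0]; exact_mod_cast lt_of_lt_of_le (by norm_num) hL2
  obtain ⟨α₁, γ₁, hα₁, hγ₁, H⟩ := exists_energy_letters_diagonal_closed L hL φ hMφ hMφ' hφ hφ' ha hr0 hr1 τ hτ hCτ hρw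
  obtain ⟨T, hT0, hTCw, hT3, hT2⟩ := thresholds L hL2 (d := d) hα₁
  refine ⟨T, γ₁, hT0, hγ₁, ?_⟩
  intro n η hηL c₀ c₁ _ _ hw hρ m _ U αU hα1 hU1 hreg S hS hU α hα0 hαle hRS hUη hpl x
  obtain ⟨hUb, hUη', hpl', εU, hεU, hUε, hεg⟩ := windows_feed L hL2 m n hS hU hT0 hTCw hT3 hT2 hηL hα0 hαle hUη hpl
  exact H n η hηL c₀ c₁ hw hρ m U αU hα1 hU1 hreg εU hεU hUε hα₁.le le_rfl hRS hUb hUη' hpl' hεg x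

/-- **THE FLAT `D`-ROWS OF `G_k(U)y` ON THE DIAGONAL FROM THE TWO WINDOWS** (the owner's (B2) re-issued): `∃ α₀ C > 0` before every binder; for ANY positivity witness,
`‖curl₁(G_k(U)y)‖ ≤ C‖y‖`, `‖div₁(G_k(U)y)‖ ≤ C‖y‖`. [cite: Balaban1985BackgroundPropagators, Thm 3.4 p.400, Thm 3.11 p.416, (3.153) p.426, (3.35)–(3.37) p.396; Balaban1985Averaging, Prop. 2 (52)–(54) p.26] -/
theorem exists_norm_G1k_rows_le_twoWindows :
    ∃ α₀ C : ℝ, 0 < α₀ ∧ 0 < C ∧ ∀ (n : ℕ) (η : ℝ), η * (L : ℝ) ^ (n + 1) = 1 →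
      ∀ (c₀ c₁ : ℝ) [Fact (0 < c₀)] [Fact (0 < c₁)], c₀ * ((L : ℝ) ^ (n + 1)) ^ d = c₁ → |η| ^ d / c₀ ≤ ρw →
      ∀ (m : Fin d → ℕ) [∀ i, NeZero (m i)] (U : Bond d (towerP L m (n + 1)) → 𝔸ˣ) (αU : ℕ → ℝ) (hα1 : ∀ j, αU j ≤ 1 / 64)
        (hU1 : ∀ (j : ℕ) (x : B7Prop1Explicit.Site d) (κ : Fin d), perCfg (towerP L m (j + 1)) (UlevOf L m (n + 1) U j) x κ ∈ U1 𝔸)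
        (hreg : ∀ (j : ℕ) (y : TSite d (towerP L m j)) (κ : Fin d) (r : Fin d → Fin L),
          ‖((Wcx L (perCfg (towerP L m (j + 1)) (UlevOf L m (n + 1) U j)) (cornerSite L y) κ (boxVec L r) : 𝔸ˣ) : 𝔸) - 1‖ ≤ αU j)
        {S : Subgroup 𝔸ˣ}, AvgClosed d L S → (∀ b, U b ∈ S) →
      ∀ {α : ℝ}, 0 ≤ α → α ≤ α₀ →
        (∀ (b : Bond d (towerP L m (n + 1))) (v u : W), ⟪adTransportW φ U b v, u⟫_ℂ = ⟪v, adTransportW φ (fun b => (U b)⁻¹) b u⟫_ℂ) →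
        (∀ b, ‖(U b : 𝔸) - 1‖ ≤ α * η) →
        (∀ p : B9SectCLatticeCarrier.Plaq d (towerP L m (n + 1)), ‖(plaqHolU U p : 𝔸) - 1‖ ≤ α * η ^ 2) →
        ∀ (hpos : ∀ x : BondL2K ℂ d (towerP L m (n + 1)) c₀ W, x ≠ 0 →
            0 < RCLike.re ⟪x, laplaceAk L m n φ η U hL αU hα1 hU1 hreg τ (c₀ := c₀) (c₁ := c₁) a x⟫_ℂ)
          (y : BondL2K ℂ d (towerP L m (n + 1)) c₀ W),
          ‖covCurlL2K ℂ c₀ ((η : ℂ))⁻¹ (adTransportW φ (fun _ : Bond d (towerP L m (n + 1)) => (1 : 𝔸ˣ))) (G1LatticeK hpos y)‖ ≤ C * ‖y‖ ∧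
          ‖covDivL2K ℂ c₀ ((η : ℂ))⁻¹ (adTransportW φ fun _ : Bond d (towerP L m (n + 1)) => (1 : 𝔸ˣ)⁻¹) (G1LatticeK hpos y)‖ ≤ C * ‖y‖ := by
  have hL0 : (0 : ℝ) < L := by exact_mod_cast lt_of_lt_of_le (by norm_num) hL2
  have hr0 : (0 : ℝ) ≤ 1 / (L : ℝ) := by positivity
  have hr1 : 1 / (L : ℝ) < 1 := by rw [div_lt_one hL0]; exact_mod_cast lt_of_lt_of_le (by norm_num) hL2
  obtain ⟨α₁, C, hα₁, hC, H⟩ := exists_norm_G1k_rows_le_diagonal_closed L hL φ hMφ hMφ' hφ hφ' ha hr0 hr1 τ hτ hCτ hρw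
  obtain ⟨T, hT0, hTCw, hT3, hT2⟩ := thresholds L hL2 (d := d) hα₁
  refine ⟨T, C, hT0, hC, ?_⟩
  intro n η hηL c₀ c₁ _ _ hw hρ m _ U αU hα1 hU1 hreg S hS hU α hα0 hαle hRS hUη hpl hpos y
  obtain ⟨hUb, hUη', hpl', εU, hεU, hUε, hεg⟩ := windows_feed L hL2 m n hS hU hT0 hTCw hT3 hT2 hηL hα0 hαle hUη hpl
  exact H n η hηL c₀ c₁ hw hρ m U αU hα1 hU1 hreg εU hεU hUε hα₁.le le_rfl hRS hUb hUη' hpl' hεg hpos y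

/-- **`‖H_{1,k}(U)(Q_k(U)(G_k(U)y))‖` AND ITS FLAT `D`-ROWS `≤ C‖y‖` ON THE DIAGONAL FROM THE TWO WINDOWS** (the owner's (B3) re-issued; `hsymm`, any `hpos`, any `hQ`).
[cite: Balaban1985BackgroundPropagators, (3.126) p.420, (3.153) p.426, Thm 3.11 p.416, (3.35)–(3.37) p.396; Balaban1985Variational, (45) p.285] -/
theorem exists_norm_H1k_Qk_G1k_le_twoWindows :
    ∃ α₀ C : ℝ, 0 < α₀ ∧ 0 < C ∧ ∀ (n : ℕ) (η : ℝ), η * (L : ℝ) ^ (n + 1) = 1 →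
      ∀ (c₀ c₁ : ℝ) [Fact (0 < c₀)] [Fact (0 < c₁)], c₀ * ((L : ℝ) ^ (n + 1)) ^ d = c₁ → |η| ^ d / c₀ ≤ ρw →
      ∀ (m : Fin d → ℕ) [∀ i, NeZero (m i)] (U : Bond d (towerP L m (n + 1)) → 𝔸ˣ) (αU : ℕ → ℝ) (hα1 : ∀ j, αU j ≤ 1 / 64)
        (hU1 : ∀ (j : ℕ) (x : B7Prop1Explicit.Site d) (κ : Fin d), perCfg (towerP L m (j + 1)) (UlevOf L m (n + 1) U j) x κ ∈ U1 𝔸)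
        (hreg : ∀ (j : ℕ) (y : TSite d (towerP L m j)) (κ : Fin d) (r : Fin d → Fin L),
          ‖((Wcx L (perCfg (towerP L m (j + 1)) (UlevOf L m (n + 1) U j)) (cornerSite L y) κ (boxVec L r) : 𝔸ˣ) : 𝔸) - 1‖ ≤ αU j)
        {S : Subgroup 𝔸ˣ}, AvgClosed d L S → (∀ b, U b ∈ S) →
      ∀ {α : ℝ}, 0 ≤ α → α ≤ α₀ →
        (∀ (b : Bond d (towerP L m (n + 1))) (v u : W), ⟪adTransportW φ U b v, u⟫_ℂ = ⟪v, adTransportW φ (fun b => (U b)⁻¹) b u⟫_ℂ) →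
        (∀ b, ‖(U b : 𝔸) - 1‖ ≤ α * η) →
        (∀ p : B9SectCLatticeCarrier.Plaq d (towerP L m (n + 1)), ‖(plaqHolU U p : 𝔸) - 1‖ ≤ α * η ^ 2) →
        (laplaceAk L m n φ η U hL αU hα1 hU1 hreg τ (c₀ := c₀) (c₁ := c₁) a).IsSymmetric →
        ∀ (hpos : ∀ x : BondL2K ℂ d (towerP L m (n + 1)) c₀ W, x ≠ 0 →
            0 < RCLike.re ⟪x, laplaceAk L m n φ η U hL αU hα1 hU1 hreg τ (c₀ := c₀) (c₁ := c₁) a x⟫_ℂ)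
          (hQ : Function.Surjective (QkW L m n φ U hL αU hα1 hU1 hreg (c₁ := c₁)))
          (y : BondL2K ℂ d (towerP L m (n + 1)) c₀ W),
          ‖H1LatticeK hpos hQ (QkW L m n φ U hL αU hα1 hU1 hreg (c₁ := c₁) (G1LatticeK hpos y))‖ ≤ C * ‖y‖ ∧
          ‖covCurlL2K ℂ c₀ ((η : ℂ))⁻¹ (adTransportW φ (fun _ : Bond d (towerP L m (n + 1)) => (1 : 𝔸ˣ)))
              (H1LatticeK hpos hQ (QkW L m n φ U hL αU hα1 hU1 hreg (c₁ := c₁) (G1LatticeK hpos y)))‖ ≤ C * ‖y‖ ∧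
          ‖covDivL2K ℂ c₀ ((η : ℂ))⁻¹ (adTransportW φ fun _ : Bond d (towerP L m (n + 1)) => (1 : 𝔸ˣ)⁻¹)
              (H1LatticeK hpos hQ (QkW L m n φ U hL αU hα1 hU1 hreg (c₁ := c₁) (G1LatticeK hpos y)))‖ ≤ C * ‖y‖ := by
  have hL0 : (0 : ℝ) < L := by exact_mod_cast lt_of_lt_of_le (by norm_num) hL2
  have hr0 : (0 : ℝ) ≤ 1 / (L : ℝ) := by positivity
  have hr1 : 1 / (L : ℝ) < 1 := by rw [div_lt_one hL0]; exact_mod_cast lt_of_lt_of_le (by norm_num) hL2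
  obtain ⟨α₁, C, hα₁, hC, H⟩ := exists_norm_H1k_Qk_G1k_le_diagonal_closed L hL φ hMφ hMφ' hφ hφ' ha hr0 hr1 τ hτ hCτ hρw
  obtain ⟨T, hT0, hTCw, hT3, hT2⟩ := thresholds L hL2 (d := d) hα₁
  refine ⟨T, C, hT0, hC, ?_⟩
  intro n η hηL c₀ c₁ _ _ hw hρ m _ U αU hα1 hU1 hreg S hS hU α hα0 hαle hRS hUη hpl hsymm hpos hQ y
  obtain ⟨hUb, hUη', hpl', εU, hεU, hUε, hεg⟩ := windows_feed L hL2 m n hS hU hT0 hTCw hT3 hT2 hηL hα0 hαle hUη hpl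
  exact H n η hηL c₀ c₁ hw hρ m U αU hα1 hU1 hreg εU hεU hUε hα₁.le le_rfl hRS hUb hUη' hpl' hεg hsymm hpos hQ y

/-- **`‖𝔊_k(U)x‖, ‖curl₁(𝔊_k(U)x)‖, ‖div₁(𝔊_k(U)x)‖ ≤ C‖x‖` ON THE DIAGONAL FROM THE TWO WINDOWS** — [B9] Thm 3.13's `L²`∕energy clause for the third Green's letter
(the owner's (B4) re-issued; `hsymm`, any `hpos`, any `hQ`). [cite: Balaban1985BackgroundPropagators, Thm 3.13 p.427, (3.153) p.426, Thm 3.11 p.416, (3.35)–(3.37) p.396; Balaban1985Averaging, Prop. 2 (52)–(54) p.26] -/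
theorem exists_norm_frakGk_le_twoWindows :
    ∃ α₀ C : ℝ, 0 < α₀ ∧ 0 < C ∧ ∀ (n : ℕ) (η : ℝ), η * (L : ℝ) ^ (n + 1) = 1 →
      ∀ (c₀ c₁ : ℝ) [Fact (0 < c₀)] [Fact (0 < c₁)], c₀ * ((L : ℝ) ^ (n + 1)) ^ d = c₁ → |η| ^ d / c₀ ≤ ρw →
      ∀ (m : Fin d → ℕ) [∀ i, NeZero (m i)] (U : Bond d (towerP L m (n + 1)) → 𝔸ˣ) (αU : ℕ → ℝ) (hα1 : ∀ j, αU j ≤ 1 / 64)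
        (hU1 : ∀ (j : ℕ) (x : B7Prop1Explicit.Site d) (κ : Fin d), perCfg (towerP L m (j + 1)) (UlevOf L m (n + 1) U j) x κ ∈ U1 𝔸)
        (hreg : ∀ (j : ℕ) (y : TSite d (towerP L m j)) (κ : Fin d) (r : Fin d → Fin L),
          ‖((Wcx L (perCfg (towerP L m (j + 1)) (UlevOf L m (n + 1) U j)) (cornerSite L y) κ (boxVec L r) : 𝔸ˣ) : 𝔸) - 1‖ ≤ αU j)
        {S : Subgroup 𝔸ˣ}, AvgClosed d L S → (∀ b, U b ∈ S) →
      ∀ {α : ℝ}, 0 ≤ α → α ≤ α₀ →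
        (∀ (b : Bond d (towerP L m (n + 1))) (v u : W), ⟪adTransportW φ U b v, u⟫_ℂ = ⟪v, adTransportW φ (fun b => (U b)⁻¹) b u⟫_ℂ) →
        (∀ b, ‖(U b : 𝔸) - 1‖ ≤ α * η) →
        (∀ p : B9SectCLatticeCarrier.Plaq d (towerP L m (n + 1)), ‖(plaqHolU U p : 𝔸) - 1‖ ≤ α * η ^ 2) →
        (laplaceAk L m n φ η U hL αU hα1 hU1 hreg τ (c₀ := c₀) (c₁ := c₁) a).IsSymmetric →
        ∀ (hpos : ∀ x : BondL2K ℂ d (towerP L m (n + 1)) c₀ W, x ≠ 0 →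
            0 < RCLike.re ⟪x, laplaceAk L m n φ η U hL αU hα1 hU1 hreg τ (c₀ := c₀) (c₁ := c₁) a x⟫_ℂ)
          (hQ : Function.Surjective (QkW L m n φ U hL αU hα1 hU1 hreg (c₁ := c₁)))
          (x : BondL2K ℂ d (towerP L m (n + 1)) c₀ W),
          ‖frakGLatticeK hpos hQ x‖ ≤ C * ‖x‖ ∧
          ‖covCurlL2K ℂ c₀ ((η : ℂ))⁻¹ (adTransportW φ (fun _ : Bond d (towerP L m (n + 1)) => (1 : 𝔸ˣ))) (frakGLatticeK hpos hQ x)‖ ≤ C * ‖x‖ ∧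
          ‖covDivL2K ℂ c₀ ((η : ℂ))⁻¹ (adTransportW φ fun _ : Bond d (towerP L m (n + 1)) => (1 : 𝔸ˣ)⁻¹) (frakGLatticeK hpos hQ x)‖ ≤ C * ‖x‖ := by
  have hL0 : (0 : ℝ) < L := by exact_mod_cast lt_of_lt_of_le (by norm_num) hL2
  have hr0 : (0 : ℝ) ≤ 1 / (L : ℝ) := by positivity
  have hr1 : 1 / (L : ℝ) < 1 := by rw [div_lt_one hL0]; exact_mod_cast lt_of_lt_of_le (by norm_num) hL2
  obtain ⟨α₁, C, hα₁, hC, H⟩ := exists_norm_frakGk_le_diagonal_closed L hL φ hMφ hMφ' hφ hφ' ha hr0 hr1 τ hτ hCτ hρw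
  obtain ⟨T, hT0, hTCw, hT3, hT2⟩ := thresholds L hL2 (d := d) hα₁
  refine ⟨T, C, hT0, hC, ?_⟩
  intro n η hηL c₀ c₁ _ _ hw hρ m _ U αU hα1 hU1 hreg S hS hU α hα0 hαle hRS hUη hpl hsymm hpos hQ x
  obtain ⟨hUb, hUη', hpl', εU, hεU, hUε, hεg⟩ := windows_feed L hL2 m n hS hU hT0 hTCw hT3 hT2 hηL hα0 hαle hUη hpl
  exact H n η hηL c₀ c₁ hw hρ m U αU hα1 hU1 hreg εU hεU hUε hα₁.le le_rfl hRS hUb hUη' hpl' hεg hsymm hpos hQ x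

end Green

end Literature.MathematicalPhysics.QuantumFieldTheory.Balaban1983to89.B9Eq3153FrakGkBoundTwoWindows

end
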